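import Literature.Topology.FourManifolds.CerfDiscConnected
import Literature.Topology.FourManifolds.CerfAppendixPropositionOneConverse
import Literature.Topology.FourManifolds.ClosedBallTangent
import Mathlib.Analysis.InnerProductSpace.Projection.FiniteDimensional
import HarnessLib

/-!
# Cerf, Ch. I §2: the named fact is equivalent to (4) « le groupe `Diff D³` est connexe »

Topic `Literature/Topology/FourManifolds`. J. Cerf, *Sur les difféomorphismes de la sphère de
dimension trois (Γ₄ = 0)*, LNM 53 (1968), Ch. I §2, proves « (2) équivaut à (4) `π₀(𝒢) = 0` »,
`𝒢 = Diff D³` (orientation-preserving diffeomorphisms, Ch. I §1), from the exact sequence (3) of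
the fibration `Diff D³ → Diff S²` and Smale's theorem: « 1° `π₀(ℋ) = 0`; 2° L'application
`π₁(𝒢) → π₁(ℋ)` est surjective ». `CerfDiscConnected.lean` proved (4) ⟹ (2) ⟹ the named fact
`Literature.Topology.FourManifolds.cerf_pi0DiffDisc_relBoundary_three` (using 2°); this file
proves the remaining implication **named fact ⟹ (4)** (using 1°, `π₀ Diff⁺ S² = 0`, Smale's
theorem at `i = 0`, `SmaleDiffDisc.lean`) and records the equivalence
`cerf_pi0DiffDisc_relBoundary_three_iff_discConnected`:

* `exists_boundaryDiffeomorph` — the boundary map of a diffeomorphism of `𝔻ⁿ⁺¹` as a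
  diffeomorphism of `𝕊ⁿ`;
* `mfderiv_closedBallCongr_of_norm_lt_one`, `closedBallCongr_reflection_isOrientationReversing`
  — a hyperplane reflection of `𝔻ⁿ⁺¹` reverses every smooth orientation (its differential at the
  centre is the reflection, of determinant `-1`);
* `isDiffeotopicToId_of_boundary_isDiffeotopicToId` — if every diffeomorphism of `𝔻ⁿ⁺¹` fixing
  `𝕊ⁿ` pointwise is diffeotopic to the identity, then so is every diffeomorphism whose boundary
  map is diffeotopic to the identity of `𝕊ⁿ` (extend the boundary diffeotopy over the disc by the
  twist construction, `exists_twistFamily`, Cerf's Lemme 2; compose);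
* `discConnected_of_cerf_pi0DiffDisc_relBoundary_three` — **named fact ⟹ (4) for `D³`**: the
  boundary map `ψ` of an orientation-preserving `G` is diffeotopic to the identity or to a
  reflection (`π₀ Diff S² = ℤ/2`, Smale); in the second case `G ∘ R⁻¹` (`R` the reflection of
  `D³`) would be diffeotopic to the identity, so `G = (G ∘ R⁻¹) ∘ R` would reverse orientation;
* `cerf_pi0DiffDisc_relBoundary_three_iff_discConnected` — **`cerf_pi0DiffDisc_relBoundary_three`
  ⟺ every orientation-preserving diffeomorphism of `D³` is diffeotopic to the identity** (for
  every smooth orientation of the closed `3`-disc): Cerf's « (2) équivaut à (4) » together with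
  Appendice §2 Prop. 1 (`CerfAppendixPropositionOne(Converse).lean`).

Everything here is proved; there are no definitions and no named facts.

## References

* J. Cerf, *Sur les difféomorphismes de la sphère de dimension trois (Γ₄ = 0)*, Lecture Notes in
  Mathematics 53, Springer (1968), Ch. I §1 (Lemme 2), Ch. I §2 ((2) ⟺ (4), 1°, 2°); Appendice §2
  Prop. 1, §5 Thm. 4. [CerfDiffeoSphere1968]
* M. W. Hirsch, *Differential Topology*, GTM 33 (1976), Ch. 4 §4. [HirschDT1976]
-/

open scoped Manifold ContDiff Topology InnerProductSpace
open Set Function Metric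

noncomputable section

namespace Literature.Topology.FourManifolds

/-- Local notation: `𝔼 n` is the model Euclidean space `EuclideanSpace ℝ (Fin n)`. -/
local notation "𝔼 " n:arg => EuclideanSpace ℝ (Fin n)

/-- Local notation: `𝕊 n` is the unit sphere in `EuclideanSpace ℝ (Fin (n + 1))`. -/
local notation "𝕊 " n:arg => (Metric.sphere (0 : EuclideanSpace ℝ (Fin (n + 1))) 1)

/-- Local notation: `𝔻 n` is the closed unit ball in `EuclideanSpace ℝ (Fin n)`. -/
local notation "𝔻 " n:arg => (Metric.closedBall (0 : EuclideanSpace ℝ (Fin n)) 1)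

attribute [local instance] fact_finrank_euclideanSpace_succ

variable {n : ℕ}

/-! ### The boundary map of a diffeomorphism of the disc -/

/-- **The boundary map of a diffeomorphism of `𝔻ⁿ⁺¹`, as a diffeomorphism of `𝕊ⁿ`** (values in
the sphere by invariance of the boundary, `norm_eq_one_of_norm_eq_one`; smooth through the
inclusions `𝕊ⁿ ↪ 𝔻ⁿ⁺¹ ↪ ℝⁿ⁺¹` and `ContMDiff.codRestrict_sphere`). [folklore] -/
theorem exists_boundaryDiffeomorph (G : (𝔻 (n + 1)) ≃ₘ⟮𝓡∂ (n + 1), 𝓡∂ (n + 1)⟯ (𝔻 (n + 1))) :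
    ∃ ψ : (𝕊 n) ≃ₘ⟮𝓡 n, 𝓡 n⟯ (𝕊 n),
      (∀ z : 𝕊 n, ((ψ z : 𝕊 n) : 𝔼 (n + 1)) =
        ((G ⟨z, sphere_subset_closedBall z.2⟩ : 𝔻 (n + 1)) : 𝔼 (n + 1))) ∧
      (∀ z : 𝕊 n, ((ψ.symm z : 𝕊 n) : 𝔼 (n + 1)) =
        ((G.symm ⟨z, sphere_subset_closedBall z.2⟩ : 𝔻 (n + 1)) : 𝔼 (n + 1))) := by
  have hincl : ContMDiff (𝓡 n) (𝓡∂ (n + 1)) ∞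
      (fun z : 𝕊 n => (⟨z, sphere_subset_closedBall z.2⟩ : 𝔻 (n + 1))) :=
    (contMDiff_coe_sphere (E := 𝔼 (n + 1)) (n := n)).codRestrict_closedBall
      fun z => sphere_subset_closedBall z.2
  set f : (𝕊 n) → 𝔼 (n + 1) := fun z => (G ⟨z, sphere_subset_closedBall z.2⟩ : 𝔼 (n + 1)) with hf
  set g : (𝕊 n) → 𝔼 (n + 1) := fun z => (G.symm ⟨z, sphere_subset_closedBall z.2⟩ : 𝔼 (n + 1))
    with hg
  have hfs : ContMDiff (𝓡 n) 𝓘(ℝ, 𝔼 (n + 1)) ∞ f :=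
    contMDiff_coe_closedBall.comp (G.contMDiff.comp hincl)
  have hgs : ContMDiff (𝓡 n) 𝓘(ℝ, 𝔼 (n + 1)) ∞ g :=
    contMDiff_coe_closedBall.comp (G.symm.contMDiff.comp hincl)
  have hf1 : ∀ z, f z ∈ 𝕊 n := fun z => mem_sphere_zero_iff_norm.2
    (norm_eq_one_of_norm_eq_one G.toHomeomorph (mem_sphere_zero_iff_norm.1 z.2))
  have hg1 : ∀ z, g z ∈ 𝕊 n := fun z => mem_sphere_zero_iff_norm.2
    (norm_eq_one_of_norm_eq_one G.toHomeomorph.symm (mem_sphere_zero_iff_norm.1 z.2))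
  refine ⟨{ toFun := fun z => ⟨f z, hf1 z⟩
            invFun := fun z => ⟨g z, hg1 z⟩
            left_inv := fun z => ?_
            right_inv := fun z => ?_
            contMDiff_toFun := hfs.codRestrict_sphere hf1
            contMDiff_invFun := hgs.codRestrict_sphere hg1 }, fun z => rfl, fun z => rfl⟩
  · apply Subtype.ext
    show (G.symm ⟨(G ⟨z, _⟩ : 𝔼 (n + 1)), _⟩ : 𝔼 (n + 1)) = z
    have : (⟨((G ⟨z, sphere_subset_closedBall z.2⟩ : 𝔻 (n + 1)) : 𝔼 (n + 1)),
        sphere_subset_closedBall (hf1 z)⟩ : 𝔻 (n + 1)) = G ⟨z, sphere_subset_closedBall z.2⟩ :=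
      Subtype.ext rfl
    rw [this, G.symm_apply_apply]
  · apply Subtype.ext
    show (G ⟨(G.symm ⟨z, _⟩ : 𝔼 (n + 1)), _⟩ : 𝔼 (n + 1)) = z
    have : (⟨((G.symm ⟨z, sphere_subset_closedBall z.2⟩ : 𝔻 (n + 1)) : 𝔼 (n + 1)),
        sphere_subset_closedBall (hg1 z)⟩ : 𝔻 (n + 1)) = G.symm ⟨z, sphere_subset_closedBall z.2⟩ :=
      Subtype.ext rfl
    rw [this, G.apply_symm_apply]

/-! ### Hyperplane reflections of the disc reverse orientation -/

/-- **The differential of `closedBallCongr A` at an interior point is `A`** (read through the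
differential of the inclusion `𝔻ⁿ⁺¹ ↪ ℝⁿ⁺¹`, which is the identity at interior points,
`closedBallCoeDeriv_of_norm_lt_one`). [folklore] -/
theorem mfderiv_closedBallCongr_of_norm_lt_one (A : 𝔼 (n + 1) ≃ₗᵢ[ℝ] 𝔼 (n + 1))
    {x : 𝔻 (n + 1)} (hx : ‖(x : 𝔼 (n + 1))‖ < 1) :
    mfderiv (𝓡∂ (n + 1)) (𝓡∂ (n + 1)) (closedBallCongr A) x =
      ((A : 𝔼 (n + 1) →L[ℝ] 𝔼 (n + 1)) : 𝔼 (n + 1) →L[ℝ] 𝔼 (n + 1)) := by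
  set R := closedBallCongr A with hR
  have hRx : ‖((R x : 𝔻 (n + 1)) : 𝔼 (n + 1))‖ < 1 := by
    rw [hR, coe_closedBallCongr, LinearIsometryEquiv.norm_map]; exact hx
  have hRd : HasMFDerivAt (𝓡∂ (n + 1)) (𝓡∂ (n + 1)) R x (mfderiv (𝓡∂ (n + 1)) (𝓡∂ (n + 1)) R x) :=
    (R.contMDiff.mdifferentiableAt (by simp)).hasMFDerivAt
  -- `val ∘ R = A ∘ val`
  have h1 : HasMFDerivAt (𝓡∂ (n + 1)) 𝓘(ℝ, 𝔼 (n + 1)) (Subtype.val ∘ R) x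
      ((closedBallCoeDeriv (R x) : 𝔼 (n + 1) →L[ℝ] 𝔼 (n + 1)).comp
        (mfderiv (𝓡∂ (n + 1)) (𝓡∂ (n + 1)) R x)) :=
    (hasMFDerivAt_coe_closedBall (R x)).comp x hRd
  have h2 : mfderiv (𝓡∂ (n + 1)) 𝓘(ℝ, 𝔼 (n + 1)) (fun y : 𝔻 (n + 1) => A y) x =
      (fderiv ℝ (fun w : 𝔼 (n + 1) => A w) (x : 𝔼 (n + 1))).comp
        (closedBallCoeDeriv x : 𝔼 (n + 1) →L[ℝ] 𝔼 (n + 1)) :=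
    mfderiv_comp_coe_closedBall x (A.toContinuousLinearEquiv.differentiableAt)
  have h12 : (Subtype.val ∘ R : (𝔻 (n + 1)) → 𝔼 (n + 1)) = fun y : 𝔻 (n + 1) => A y :=
    funext fun y => rfl
  rw [h12] at h1
  have h3 := h1.mfderiv
  rw [h2, closedBallCoeDeriv_of_norm_lt_one hx, closedBallCoeDeriv_of_norm_lt_one hRx,
    ContinuousLinearMap.id_comp, ContinuousLinearMap.comp_id] at h3
  have h4 : fderiv ℝ (fun w : 𝔼 (n + 1) => A w) (x : 𝔼 (n + 1)) =
      ((A : 𝔼 (n + 1) →L[ℝ] 𝔼 (n + 1)) : 𝔼 (n + 1) →L[ℝ] 𝔼 (n + 1)) :=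
    A.toContinuousLinearEquiv.hasFDerivAt.fderiv
  exact h3.symm.trans h4

/-- **A hyperplane reflection of `𝔻ⁿ⁺¹` reverses every smooth orientation** of the closed disc:
on the connected disc it preserves or reverses (dichotomy), and preserving would force
`0 < det A = -1` at the centre, a fixed point where the differential is the reflection `A`.
Hirsch (1976), Ch. 4 §4 ("reflection in a hyperplane always reverses orientation").
[cite: HirschDT1976, §4.4 pp. 105–106] -/
theorem closedBallCongr_reflection_isOrientationReversing {e₀ : 𝔼 (n + 1)} (he₀ : e₀ ≠ 0)
    (o : SmoothOrientation (𝓡∂ (n + 1)) (𝔻 (n + 1))) :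
    (closedBallCongr ((ℝ ∙ e₀)ᗮ.reflection)).IsOrientationReversing o o := by
  haveI : ConnectedSpace (𝔻 (n + 1)) :=
    isConnected_iff_connectedSpace.1
      ((convex_closedBall (0 : 𝔼 (n + 1)) 1).isPathConnected ⟨0, by simp⟩).isConnected
  set A : 𝔼 (n + 1) ≃ₗᵢ[ℝ] 𝔼 (n + 1) := (ℝ ∙ e₀)ᗮ.reflection with hA
  rcases Diffeomorph.isOrientationPreserving_or_isOrientationReversing_holds (closedBallCongr A)
    (by simp) o o with h | h
  · exfalso
    set c : 𝔻 (n + 1) := ⟨0, by simp⟩ with hc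
    have hc0 : ‖(c : 𝔼 (n + 1))‖ < 1 := by simp [hc]
    have hfix : closedBallCongr A c = c := Subtype.ext (by rw [coe_closedBallCongr]; simp [hc])
    have h1 := (h c).1 (by rw [hfix])
    rw [mfderiv_closedBallCongr_of_norm_lt_one A hc0] at h1
    have hdet : LinearMap.det ((A : 𝔼 (n + 1) →L[ℝ] 𝔼 (n + 1)) : 𝔼 (n + 1) →ₗ[ℝ] 𝔼 (n + 1)) = -1 := by
      have h2 := (ℝ ∙ e₀)ᗮ.det_reflection
      rw [Submodule.orthogonal_orthogonal, finrank_span_singleton he₀, pow_one] at h2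
      exact h2
    have h3 : (0 : ℝ) < -1 := lt_of_lt_of_eq h1 hdet
    linarith
  · exact h

/-! ### Extending a boundary diffeotopy over the disc -/

/-- **If every diffeomorphism of `𝔻ⁿ⁺¹` fixing the sphere pointwise is diffeotopic to the
identity, then so is every diffeomorphism whose boundary map is diffeotopic to the identity of
`𝕊ⁿ`.** Extend the (stationary) boundary diffeotopy `h_t` over the disc by the twist
`T_t x = ‖x‖ • h_{tλ(‖x‖)}(x/‖x‖)` (`exists_twistFamily`; Cerf's Lemme 2), a diffeotopy `E` of the
disc with `E_1 = G` on the sphere; then `E_1⁻¹ ∘ G` fixes the sphere pointwise and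
`G = E_1 ∘ (E_1⁻¹ ∘ G)`. [cite: CerfDiffeoSphere1968, Ch. I §1, Lemme 2; Ch. I §2] -/
theorem isDiffeotopicToId_of_boundary_isDiffeotopicToId
    (hiii : ∀ K : (𝔻 (n + 1)) ≃ₘ⟮𝓡∂ (n + 1), 𝓡∂ (n + 1)⟯ (𝔻 (n + 1)),
      (∀ x : 𝔻 (n + 1), ‖(x : 𝔼 (n + 1))‖ = 1 → K x = x) → Diffeomorph.IsDiffeotopicToId K)
    (G : (𝔻 (n + 1)) ≃ₘ⟮𝓡∂ (n + 1), 𝓡∂ (n + 1)⟯ (𝔻 (n + 1)))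
    (ψ : (𝕊 n) ≃ₘ⟮𝓡 n, 𝓡 n⟯ (𝕊 n))
    (hψ : ∀ z : 𝕊 n, ((ψ z : 𝕊 n) : 𝔼 (n + 1)) =
      ((G ⟨z, sphere_subset_closedBall z.2⟩ : 𝔻 (n + 1)) : 𝔼 (n + 1)))
    (hψD : Diffeomorph.IsDiffeotopicToId ψ) : Diffeomorph.IsDiffeotopicToId G := by
  have v : 𝕊 n := ⟨EuclideanSpace.single 0 1, by simp⟩
  -- a stationary diffeotopy of the sphere from `id` to `ψ`
  obtain ⟨D₀, hD₀⟩ := hψD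
  obtain ⟨D, hD_def⟩ : ∃ D : Diffeotopy (𝓡 n) (𝕊 n),
      D = D₀.reparam Real.smoothTransition Real.smoothTransition.contDiff
        Real.smoothTransition.zero := ⟨_, rfl⟩
  have hDt : ∀ t, D.toFun t = D₀.toFun (Real.smoothTransition t) := fun t => by
    rw [hD_def, Diffeotopy.reparam_toFun]
  have hDinv : ∀ t, D.invFun t = D₀.invFun (Real.smoothTransition t) := fun t => by
    rw [hD_def, Diffeotopy.reparam_invFun]
  have hD0 : ∀ t ≤ (0 : ℝ), ∀ z, D.toFun t z = z := fun t ht z => by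
    rw [hDt, Real.smoothTransition.zero_of_nonpos ht, Diffeotopy.toFun_zero]; rfl
  have hD1 : ∀ z, D.toFun 1 z = ψ z := fun z => by
    rw [hDt, Real.smoothTransition.one, ← Diffeotopy.coe_stage, hD₀]
  -- the twist family of the (σ-constant) family `D_t`
  have hF : ContMDiff (𝓘(ℝ, ℝ).prod (𝓘(ℝ, ℝ).prod (𝓡 n))) (𝓡 n) ∞
      (fun p : ℝ × (ℝ × 𝕊 n) => D.toFun p.2.1 p.2.2) :=
    D.contMDiff_uncurry_toFun.comp contMDiff_snd
  have hFinv : ContMDiff (𝓘(ℝ, ℝ).prod (𝓘(ℝ, ℝ).prod (𝓡 n))) (𝓡 n) ∞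
      (fun p : ℝ × (ℝ × 𝕊 n) => D.invFun p.2.1 p.2.2) :=
    D.contMDiff_uncurry_invFun.comp contMDiff_snd
  obtain ⟨T, Tinv, hT, hTinv, hTT1, hTT2, hTn, hTinvn, hTsph, hTinvsph, hT0, -, -⟩ :=
    exists_twistFamily (F := fun (_ : ℝ) t z => D.toFun t z) (Finv := fun (_ : ℝ) t z => D.invFun t z)
      v hF hFinv (fun _ t z => D.invFun_toFun t z) (fun _ t z => D.toFun_invFun t z)
      (fun _ t ht z => hD0 t ht z)
  -- the extension `E` of the boundary diffeotopy over the disc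
  have hkE : ContDiff ℝ ∞ (fun q : ℝ × 𝔼 (n + 1) => T 0 q.1 q.2) :=
    hT.comp (contDiff_const.prodMk contDiff_id)
  have hkE' : ContDiff ℝ ∞ (fun q : ℝ × 𝔼 (n + 1) => Tinv 0 q.1 q.2) :=
    hTinv.comp (contDiff_const.prodMk contDiff_id)
  have hTD : ∀ t (x : 𝔻 (n + 1)), T 0 t x ∈ 𝔻 (n + 1) := fun t x =>
    mem_closedBall_zero_iff.2 ((hTn 0 t x).le.trans (mem_closedBall_zero_iff.1 x.2))
  have hTinvD : ∀ t (x : 𝔻 (n + 1)), Tinv 0 t x ∈ 𝔻 (n + 1) := fun t x =>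
    mem_closedBall_zero_iff.2 ((hTinvn 0 t x).le.trans (mem_closedBall_zero_iff.1 x.2))
  obtain ⟨E, hE, -⟩ := Diffeotopy.exists_ofAmbient (n := n)
    (k := fun q : ℝ × 𝔼 (n + 1) => T 0 q.1 q.2) (k' := fun q : ℝ × 𝔼 (n + 1) => Tinv 0 q.1 q.2)
    hkE hkE' hTD hTinvD (fun t x => hTT1 0 t x) (fun t x => hTT2 0 t x) (fun x => hT0 0 0 le_rfl x)
  have hE' : ∀ (t : ℝ) (x : 𝔻 (n + 1)), ((E.toFun t x : 𝔻 (n + 1)) : 𝔼 (n + 1)) = T 0 t x :=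
    fun t x => hE t x
  -- `E_1 = G` on the sphere
  have hE1 : ∀ x : 𝔻 (n + 1), ‖(x : 𝔼 (n + 1))‖ = 1 → E.toFun 1 x = G x := by
    intro x hx
    have hz : (x : 𝔼 (n + 1)) ∈ 𝕊 n := mem_sphere_zero_iff_norm.2 hx
    apply Subtype.ext
    rw [hE', show T 0 1 (x : 𝔼 (n + 1)) = ((D.toFun 1 ⟨x, hz⟩ : 𝕊 n) : 𝔼 (n + 1)) from
      hTsph 0 1 ⟨x, hz⟩, hD1, hψ]
  -- `K = E_1⁻¹ ∘ G` fixes the sphere pointwise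
  set K := G.trans (E.stage 1).symm with hK
  have hKfix : ∀ x : 𝔻 (n + 1), ‖(x : 𝔼 (n + 1))‖ = 1 → K x = x := by
    intro x hx
    rw [hK, Diffeomorph.coe_trans, comp_apply, ← hE1 x hx, ← Diffeotopy.coe_stage,
      Diffeomorph.symm_apply_apply]
  have hKD : Diffeomorph.IsDiffeotopicToId K := hiii K hKfix
  have hED : Diffeomorph.IsDiffeotopicToId (E.stage 1) := ⟨E, rfl⟩
  have heq : K.trans (E.stage 1) = G := by
    ext x
    rw [hK, Diffeomorph.coe_trans, comp_apply, Diffeomorph.coe_trans, comp_apply,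
      Diffeomorph.apply_symm_apply]
  rw [← heq]
  exact hKD.trans hED

/-! ### `n + 1 = 3`: the named fact implies (4) -/

/-- **The named fact `cerf_pi0DiffDisc_relBoundary_three` implies Cerf's (4) for `D³`**: every
orientation-preserving diffeomorphism `G` of the closed `3`-disc (for any smooth orientation) is
diffeotopic to the identity. Its boundary map `ψ ∈ Diff(S²)` is diffeotopic to the identity or to
a hyperplane reflection (Smale, `π₀ Diff S² = ℤ/2`:
`Diffeomorph.isDiffeotopicToId_or_isDiffeotopic_sphereReflection_two`); in the first case
`isDiffeotopicToId_of_boundary_isDiffeotopicToId` applies, with the hypothesis on sphere-fixing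
diffeomorphisms supplied by the named fact
(`forall_isDiffeotopicToId_of_cerf_pi0DiffDisc_relBoundary_three`); in the second, the same
argument applied to `G ∘ R⁻¹` (`R` the reflection of `D³`) makes `G = (G ∘ R⁻¹) ∘ R` orientation
reversing (`closedBallCongr_reflection_isOrientationReversing`), a contradiction. This is Cerf's
"(2) ⟹ (4)" (using 1° `π₀(ℋ) = 0`). [cite: CerfDiffeoSphere1968, Ch. I §2, (2) ⟹ (4), 1°] -/
theorem discConnected_of_cerf_pi0DiffDisc_relBoundary_three (h : cerf_pi0DiffDisc_relBoundary_three)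
    (o : SmoothOrientation (𝓡∂ 3) (𝔻 3)) (G : (𝔻 3) ≃ₘ⟮𝓡∂ 3, 𝓡∂ 3⟯ (𝔻 3))
    (hG : G.IsOrientationPreserving o o) : Diffeomorph.IsDiffeotopicToId G := by
  have hiii := forall_isDiffeotopicToId_of_cerf_pi0DiffDisc_relBoundary_three h
  have v : 𝕊 2 := ⟨EuclideanSpace.single 0 1, by simp⟩
  obtain ⟨ψ, hψ, -⟩ := exists_boundaryDiffeomorph G
  rcases Diffeomorph.isDiffeotopicToId_or_isDiffeotopic_sphereReflection_two v ψ with hA | hB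
  · exact isDiffeotopicToId_of_boundary_isDiffeotopicToId hiii G ψ hψ hA
  · exfalso
    have hv0 : ((v : 𝕊 2) : 𝔼 3) ≠ 0 := ne_zero_of_mem_unit_sphere v
    set A : 𝔼 3 ≃ₗᵢ[ℝ] 𝔼 3 := (ℝ ∙ ((v : 𝕊 2) : 𝔼 3))ᗮ.reflection with hA_def
    set R : (𝔻 3) ≃ₘ⟮𝓡∂ 3, 𝓡∂ 3⟯ (𝔻 3) := closedBallCongr A with hR
    -- `G'' = G ∘ R⁻¹` has boundary map `ψ ∘ r⁻¹`, diffeotopic to the identity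
    set G'' := R.symm.trans G with hG''
    obtain ⟨ψ'', hψ'', -⟩ := exists_boundaryDiffeomorph G''
    have hr : sphereReflection v = sphereCongr A := sphereReflection_eq_sphereCongr v
    have hψ''eq : ψ'' = (sphereReflection v).symm.trans ψ := by
      refine Diffeomorph.ext fun z => Subtype.ext ?_
      rw [hψ'', hG'', Diffeomorph.coe_trans, comp_apply, hR, closedBallCongr_symm,
        Diffeomorph.coe_trans, comp_apply, hr, sphereCongr_symm]
      rw [show closedBallCongr A.symm ⟨(z : 𝔼 3), sphere_subset_closedBall z.2⟩ =
        ⟨((sphereCongr A.symm z : 𝕊 2) : 𝔼 3), sphere_subset_closedBall (sphereCongr A.symm z).2⟩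
        from Subtype.ext rfl]
      exact (hψ _).symm
    have hψ''D : Diffeomorph.IsDiffeotopicToId ψ'' := by rw [hψ''eq]; exact hB
    have hG''D : Diffeomorph.IsDiffeotopicToId G'' :=
      isDiffeotopicToId_of_boundary_isDiffeotopicToId hiii G'' ψ'' hψ'' hψ''D
    -- hence `G''` preserves `o` while `R` reverses it, so `G = G'' ∘ R` reverses it
    have hpres : G''.IsOrientationPreserving o o := hG''D.isOrientationPreserving o
    have hpres' : IsOrientationPreserving (-o) (-o) (G'' : (𝔻 3) → 𝔻 3) :=
      (isOrientationPreserving_neg_neg_iff o o _).2 hpres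
    have hrev : R.IsOrientationReversing o o := closedBallCongr_reflection_isOrientationReversing hv0 o
    have hcomp : IsOrientationPreserving o (-o) ((G'' : (𝔻 3) → 𝔻 3) ∘ (R : (𝔻 3) → 𝔻 3)) :=
      IsOrientationPreserving.comp_holds hpres' hrev (G''.mdifferentiable (by simp))
        (R.mdifferentiable (by simp)) (fun y => G''.det_mfderiv_ne_zero (by simp) y)
        (fun y => R.det_mfderiv_ne_zero (by simp) y)
    have heq : ((G'' : (𝔻 3) → 𝔻 3) ∘ (R : (𝔻 3) → 𝔻 3)) = G := by
      funext x
      rw [comp_apply, hG'', Diffeomorph.coe_trans, comp_apply, Diffeomorph.symm_apply_apply]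
    rw [heq] at hcomp
    haveI : Nonempty (𝔻 3) := ⟨⟨0, by simp⟩⟩
    exact hG.not_isOrientationReversing hcomp

/-- **Cerf, Ch. I §2, « (2) équivaut à (4) », threaded to the tree: the named fact
`cerf_pi0DiffDisc_relBoundary_three` is EQUIVALENT to (4), the connectedness of
`𝒢 = Diff⁺ D³`** — every diffeomorphism of the closed `3`-disc preserving a smooth orientation
is the time-one stage of a diffeotopy (Cerf's `Diff` = orientation-preserving diffeomorphisms,
components by smooth arcs). Forward `discConnected_of_cerf_pi0DiffDisc_relBoundary_three` (1°,
Smale at `i = 0`), backward `cerf_pi0DiffDisc_relBoundary_three_of_discConnected`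
(`CerfDiscConnected.lean`; 2°, Smale in families, and Appendice §2 Prop. 1). So the single
unproved Cerf leaf of the tree is exactly « le groupe `𝒢` est connexe », the statement proved by
Théorème 1′ and Chapters II–VI of the monograph. [cite: CerfDiffeoSphere1968, Ch. I §2, (2) ⟺ (4)] -/
theorem cerf_pi0DiffDisc_relBoundary_three_iff_discConnected :
    cerf_pi0DiffDisc_relBoundary_three ↔
      ∀ (o : SmoothOrientation (𝓡∂ 3) (𝔻 3)) (G : (𝔻 3) ≃ₘ⟮𝓡∂ 3, 𝓡∂ 3⟯ (𝔻 3)),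
        G.IsOrientationPreserving o o → Diffeomorph.IsDiffeotopicToId G :=
  ⟨discConnected_of_cerf_pi0DiffDisc_relBoundary_three, cerf_pi0DiffDisc_relBoundary_three_of_discConnected⟩

end Literature.Topology.FourManifolds
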